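import Literature.NumberTheory.QuadraticFields.RealQuadraticCycleIdentification
import HarnessLib

/-!
# The class number of a real quadratic field EQUALS the number of cycles of reduced ideals (by certificate);
# `h(ℚ(√74093)) = 5`, `h(ℚ(√24653)) = 4`

Topic `NumberTheory/QuadraticFields`, namespace `Literature.NumberTheory.QuadraticFields` (sub-namespace `QuadIrr` for the
certificate, `Quadratic` for the field side); continues `RealQuadraticClassNumberCycleBound.lean` (`cycleEnumCert`:
`h_K ≤ |R|`) and `RealQuadraticCycleIdentification.lean` (`exists_iterate_eq_of_mk0_eq`: equal classes ⇒ same cycle).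
Everything here is PROVED; the two `def`s are computable `Bool` plumbing for the certificate. Together the two certificates
make the classical statement "the class number of a real quadratic field is the number of cycles of reduced ideals
`[a, (b + √D)/2]`" (Jacobson–Williams, *Solving the Pell Equation*, §5.3 Thm. 5.18; Cohen, GTM 138, §5.7) a KERNEL
COMPUTATION for any given discriminant.

* `QuadIrr.redIdealOK D r` — integer test that `r = (P + √D)/Q` is reduced and ideal-shaped (`Q > 0` even, `2Q ∣ P² − D`,
  `0 < P`, `P² < D < (P + Q)²`, `Q ≤ P ∨ (Q − P)² < D`), with `isIdealShaped_of_redIdealOK`, `isReduced_of_redIdealOK`;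
* **`QuadIrr.cycleSepCert D s n R`** — `s = ⌊√D⌋`, `R` has no duplicates, every `r ∈ R` passes `redIdealOK`, returns to
  itself after some `k ∈ [1, n]` computable steps, and every iterate `cstep^[k] r`, `k ∈ [1, n]`, that belongs to `R` is `r`
  itself (the members of `R` lie on DISTINCT cycles); `eq_of_iterate_eq_of_cycleSepCert` (soundness);
* **`Quadratic.length_le_classNumber_of_cycleSepCert`**: `[K:ℚ] = 2 → d_K = D → cycleSepCert D s n R → |R| ≤ h_K`
  (`r ↦ [𝔞(r)]` is injective by `exists_iterate_eq_of_mk0_eq`); **`Quadratic.classNumber_eq_length_of_certs`**: with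
  `cycleEnumCert` as well, `h_K = |R|`;
* instances: **`classNumber_eq_five_of_discr_eq_74093`** (`74093` prime, the rung `D_31^+ = D_37^+ = D_41^+` of the
  least-all-inert ladder; five cycles of lengths `5, 7, 7, 9, 9` through `(55+√D)/218, (59+√D)/254, (59+√D)/278,
  (97+√D)/206, (97+√D)/314`), **`classNumber_eq_four_of_discr_eq_24653`** (`24653 = 89·277 = 157² + 4`, the rung
  `D_29^+`; four cycles `9, 5, 5, 1` through `(59+√D)/134, (97+√D)/74, (97+√D)/206, (157+√D)/2`), the products `h_K R_K`,
  and two regressions against the tree as `example`s: `h(1365) = 4` (four cycles `4, 6, 2, 2`; the tree's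
  `classNumber_eq_four_of_discr_eq_1365` is by Minkowski's bound and explicit relations) and `h(225077) = 1` (one cycle of
  length `53`; the tree's `classNumber_eq_one_of_discr_eq_225077` is by inert primes and norm witnesses).

First consumer: the landau-siegel rescue bed (`Zhang2022/RepairBedClassNumberFormulaRealDeep.lean`: with these the G02(i)
value `L(1, χ_D) = 2 h_K log ε_D/√D` is a kernel constant at EVERY positive modulus `D ≤ 3·10⁵` of its lists).

## References

* [JacobsonWilliams2008] M. J. Jacobson, Jr., H. C. Williams, *Solving the Pell Equation*, CMS Books in Mathematics,
  Springer (2009), §3.3 (3.32), §5.3 Thm. 5.18.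
* [Cohen1993] H. Cohen, *A Course in Computational Algebraic Number Theory*, GTM 138, §5.7 (Algorithm 5.7.1 ff.: the class
  number of a real quadratic field by cycles of reduced forms / ideals).
* [LehmerLehmerShanks1970] D. H. Lehmer, E. Lehmer, D. Shanks, Math. Comp. 24 (1970) 433–451, §1.
-/

noncomputable section

open Module NumberField

namespace Literature.NumberTheory.QuadraticFields

namespace QuadIrr

variable {D : ℕ}

/-! ### The separation certificate -/

/-- Integer test: `(P + √D)/Q` is reduced and ideal-shaped — `Q > 0` even, `2Q ∣ P² − D`, `0 < P`, `P² < D < (P + Q)²`,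
`Q ≤ P ∨ (Q − P)² < D`. [cite: JacobsonWilliams2008, §3.3 (3.32)] -/
def redIdealOK (D : ℕ) (r : QuadIrr D) : Bool :=
  decide (0 < r.Q) && decide (2 ∣ r.Q) && decide (2 * r.Q ∣ r.P ^ 2 - (D : ℤ)) && decide (0 < r.P) &&
    decide (r.P ^ 2 < (D : ℤ)) && decide ((D : ℤ) < (r.P + r.Q) ^ 2) &&
    (decide (r.Q ≤ r.P) || decide ((r.Q - r.P) ^ 2 < (D : ℤ)))

/-- **The cycle-separation certificate**: `s = ⌊√D⌋`, no duplicates in `R`, every `r ∈ R` is reduced ideal-shaped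
(`redIdealOK`), returns to itself after some `k ∈ [1, n]` computable steps, and meets no OTHER member of `R` within `n`
steps. [cite: JacobsonWilliams2008, §5.3 Thm. 5.18] -/
def cycleSepCert (D s n : ℕ) (R : List (QuadIrr D)) : Bool :=
  decide (s * s < D) && decide (D < (s + 1) * (s + 1)) && decide R.Nodup &&
    R.all fun r => redIdealOK D r &&
      (List.range' 1 n).any (fun k => (cstep s)^[k] r == r) &&
      (List.range' 1 n).all (fun k => !(R.contains ((cstep s)^[k] r)) || (cstep s)^[k] r == r)

/-- `redIdealOK` gives ideal-shapedness. [cite: JacobsonWilliams2008, §5.3 (the ideal [Q/2, (P + √D)/2])] -/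
theorem isIdealShaped_of_redIdealOK {r : QuadIrr D} (h : redIdealOK D r = true) : r.IsIdealShaped := by
  simp only [redIdealOK, Bool.and_eq_true, decide_eq_true_eq, Bool.or_eq_true] at h
  exact ⟨h.1.1.1.1.1.1, h.1.1.1.1.1.2, h.1.1.1.1.2⟩

/-- `redIdealOK` gives reducedness: `φ > 1` and `−1 < φ̄ < 0` from the integer inequalities of (3.32).
[cite: JacobsonWilliams2008, §3.3 (3.32)] -/
theorem isReduced_of_redIdealOK {r : QuadIrr D} (h : redIdealOK D r = true) : r.IsReduced := by
  simp only [redIdealOK, Bool.and_eq_true, decide_eq_true_eq, Bool.or_eq_true] at h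
  obtain ⟨⟨⟨⟨⟨⟨hQ, -⟩, hdvd⟩, hP⟩, hP2⟩, hPQ⟩, hor⟩ := h
  have hQr : (0 : ℝ) < r.Q := by exact_mod_cast hQ
  have hPr : (0 : ℝ) < r.P := by exact_mod_cast hP
  have hDpos : (0 : ℝ) < (D : ℝ) := by
    have : (0 : ℤ) < D := by nlinarith
    exact_mod_cast this
  have hs : 0 < Real.sqrt (D : ℝ) := Real.sqrt_pos.mpr hDpos
  -- `P < √D`
  have hPlt : (r.P : ℝ) < Real.sqrt D := by
    rw [Real.lt_sqrt hPr.le]; exact_mod_cast hP2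
  -- `√D < P + Q`
  have hPQlt : Real.sqrt D < (r.P : ℝ) + r.Q := by
    rw [Real.sqrt_lt' (by linarith)]; exact_mod_cast hPQ
  -- `Q < P + √D`
  have hQlt : (r.Q : ℝ) < r.P + Real.sqrt D := by
    by_cases hQP : r.Q ≤ r.P
    · have : (r.Q : ℝ) ≤ r.P := by exact_mod_cast hQP
      linarith
    · have hlt : (r.Q - r.P) ^ 2 < (D : ℤ) := by
        rcases hor with hle | hlt
        · exact absurd hle hQP
        · exact hlt
      have hpos : (0 : ℝ) ≤ (r.Q : ℝ) - r.P := by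
        have : (r.P : ℝ) < r.Q := by exact_mod_cast (show r.P < r.Q by omega)
        linarith
      have : (r.Q : ℝ) - r.P < Real.sqrt D := by
        rw [Real.lt_sqrt hpos]; exact_mod_cast hlt
      linarith
  refine ⟨hQ, ?_, ?_, ?_, ?_⟩
  · have : r.Q ∣ r.P ^ 2 - (D : ℤ) := dvd_trans ⟨2, by ring⟩ hdvd
    rw [← dvd_neg, neg_sub]; exact this
  · show 1 < (r.P + Real.sqrt D) / r.Q
    rw [lt_div_iff₀ hQr]; linarith
  · show -1 < (r.P - Real.sqrt D) / r.Q
    rw [lt_div_iff₀ hQr]; linarith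
  · show (r.P - Real.sqrt D) / r.Q < 0
    exact div_neg_of_neg_of_pos (by linarith) hQr

/-- **Soundness of the separation certificate**: the members of `R` are reduced ideal-shaped, `R` has no duplicates, and a
member of `R` on the cycle of `r ∈ R`, at a position below the period of `r`, is `r` itself.
[cite: JacobsonWilliams2008, §5.3 Thm. 5.18] -/
theorem eq_of_iterate_eq_of_cycleSepCert {D s n : ℕ} {R : List (QuadIrr D)} (h : cycleSepCert D s n R = true) :
    ¬ IsSquare D ∧ R.Nodup ∧ (∀ r ∈ R, r.IsReduced ∧ r.IsIdealShaped) ∧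
      ∀ r ∈ R, ∀ r' ∈ R, ∀ k < Function.minimalPeriod step r, r' = step^[k] r → r' = r := by
  simp only [cycleSepCert, Bool.and_eq_true, decide_eq_true_eq, List.all_eq_true, List.any_eq_true, Bool.or_eq_true,
    beq_iff_eq, Bool.not_eq_true', List.mem_range'_1] at h
  obtain ⟨⟨⟨hs1, hs2⟩, hnodup⟩, hall⟩ := h
  have hsq : s = Nat.sqrt D := Nat.eq_sqrt.mpr ⟨hs1.le, hs2⟩
  have hD : ¬ IsSquare D := fun ⟨q, hq⟩ => Nat.not_exists_sq hs1 hs2 ⟨q, hq.symm⟩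
  have hred : ∀ r ∈ R, r.IsReduced ∧ r.IsIdealShaped := fun r hr =>
    ⟨isReduced_of_redIdealOK (hall r hr).1.1, isIdealShaped_of_redIdealOK (hall r hr).1.1⟩
  refine ⟨hD, hnodup, hred, fun r hr r' hr' k hk hkr => ?_⟩
  obtain ⟨⟨-, ⟨p, ⟨hp1, hpn⟩, hp⟩⟩, hsep⟩ := hall r hr
  have hr1 := (hred r hr).1
  have hiter : ∀ j, step^[j] r = (cstep s)^[j] r := iterate_step_eq_iterate_cstep hD hsq hr1
  -- the minimal period is at most `p ≤ n`
  have hper : Function.IsPeriodicPt step p r := by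
    change step^[p] r = r; rw [hiter]; exact hp
  have hmin : Function.minimalPeriod step r ≤ p := hper.minimalPeriod_le (by omega)
  rcases Nat.eq_zero_or_pos k with rfl | hk0
  · simpa using hkr
  · have hkn : 1 ≤ k ∧ k < 1 + n := ⟨hk0, by omega⟩
    rcases hsep k hkn with hnot | heq
    · exfalso
      rw [← hiter, ← hkr] at hnot
      have : R.contains r' = true := List.contains_iff_mem.mpr hr'
      rw [this] at hnot
      exact Bool.noConfusion hnot
    · rw [hkr, hiter, heq]

end QuadIrr

/-! ### `|R| ≤ h_K` and `h_K = |R|` -/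

namespace Quadratic

open QuadIrr
open scoped nonZeroDivisors

section Count

variable {K : Type*} [Field K] [NumberField K]

/-- **The number of certified cycle representatives is at most `h_K`**: `r ↦ [𝔞(r)]` is injective on `R`, because equal
classes put `r'` on the cycle of `r` (`exists_iterate_eq_of_mk0_eq`) and the certificate separates the members of `R`.
[cite: JacobsonWilliams2008, §5.3 Thm. 5.18] -/
theorem length_le_classNumber_of_cycleSepCert (h2 : finrank ℚ K = 2) {D s n : ℕ} {R : List (QuadIrr D)}
    (hdisc : NumberField.discr K = D) (hcert : cycleSepCert D s n R = true) :
    R.length ≤ NumberField.classNumber K := by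
  classical
  obtain ⟨hD, hnodup, hred, hsep⟩ := eq_of_iterate_eq_of_cycleSepCert hcert
  have hD0 : D ≠ 0 := by rintro rfl; exact hD ⟨0, rfl⟩
  have hd : 0 < NumberField.discr K := by rw [hdisc]; exact_mod_cast Nat.pos_of_ne_zero hD0
  obtain ⟨b, hb⟩ := exists_basis_zero_eq_one (K := K) h2
  set m : ℤ := b.repr (b 1 * b 1) 0 with hm
  set t : ℤ := b.repr (b 1 * b 1) 1 with ht
  have hω : b 1 * b 1 = (m : 𝓞 K) + (t : 𝓞 K) * b 1 := basis_one_mul_self_eq b hb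
  have hDt : (D : ℤ) = t ^ 2 + 4 * m := by rw [← hdisc]; exact discr_eq_sq_add_four_mul b hb
  let I : QuadIrr D → Ideal (𝓞 K) := fun r =>
    Ideal.span {((fa r : ℤ) : 𝓞 K), b 1 - (((t - r.P) / 2 : ℤ) : 𝓞 K)}
  have hI : ∀ i : Fin R.length, I (R.get i) ∈ (Ideal (𝓞 K))⁰ := fun i =>
    span_fa_mem_nonZeroDivisors b hb (t := t) (hred _ (List.get_mem R i)).2.1 (hred _ (List.get_mem R i)).2.2.1
  let g : Fin R.length → ClassGroup (𝓞 K) := fun i => ClassGroup.mk0 ⟨I (R.get i), hI i⟩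
  have hg : Function.Injective g := by
    intro i j hij
    have hi := List.get_mem R i
    have hj := List.get_mem R j
    obtain ⟨k, hk, hkj⟩ := exists_iterate_eq_of_mk0_eq b hb hω hDt hD h2 hd (hred _ hi).2 (hred _ hi).1
      (hred _ hj).2 (hred _ hj).1 (hI i) (hI j) hij.symm
    have heq : R.get j = R.get i := hsep _ hi _ hj k hk hkj
    exact (List.nodup_iff_injective_get.mp hnodup heq).symm
  have hcard := Fintype.card_le_of_injective g hg
  rw [Fintype.card_fin] at hcard
  exact hcard

/-- **`h_K =` the number of cycles**, by the two certificates (every reduced ideal reaches `R`; the members of `R` lie on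
distinct cycles). [cite: JacobsonWilliams2008, §5.3 Thm. 5.18] -/
theorem classNumber_eq_length_of_certs (h2 : finrank ℚ K = 2) {D s n n' : ℕ} {R : List (QuadIrr D)}
    (hdisc : NumberField.discr K = D) (henum : cycleEnumCert D s n R = true) (hsep : cycleSepCert D s n' R = true) :
    NumberField.classNumber K = R.length :=
  le_antisymm (classNumber_le_of_cycleEnumCert h2 hdisc henum) (length_le_classNumber_of_cycleSepCert h2 hdisc hsep)

/-! ### Values -/

/-- **`h(ℚ(√74093)) = 5`** (`74093` prime, `D_31^+ = D_37^+ = D_41^+`): five cycles of reduced ideals, of lengths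
`5, 7, 7, 9, 9`, through `(55+√D)/218`, `(59+√D)/254`, `(59+√D)/278`, `(97+√D)/206`, `(97+√D)/314`.
[cite: JacobsonWilliams2008, §5.3 Thm. 5.18] -/
theorem classNumber_eq_five_of_discr_eq_74093 (h2 : finrank ℚ K = 2) (hd : NumberField.discr K = 74093) :
    NumberField.classNumber K = 5 :=
  classNumber_eq_length_of_certs h2 (D := 74093) (s := 272) (n := 9) (n' := 9)
    (R := [⟨55, 218⟩, ⟨59, 254⟩, ⟨59, 278⟩, ⟨97, 206⟩, ⟨97, 314⟩]) (by exact_mod_cast hd)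
    (by decide +kernel) (by decide +kernel)

/-- `d_K = 74093`: `h_K · R_K = 5 log ((1361 + 5√74093)/2)` (`= 36.07987…`). [cite: JacobsonWilliams2008, §5.3 (5.33)–(5.34)] -/
theorem classNumber_mul_regulator_of_discr_eq_74093 (h2 : finrank ℚ K = 2) (hd : NumberField.discr K = 74093) :
    (NumberField.classNumber K : ℝ) * Units.regulator K = 5 * Real.log ((1361 + 5 * Real.sqrt 74093) / 2) := by
  rw [classNumber_eq_five_of_discr_eq_74093 h2 hd, regulator_of_discr_eq_74093 h2 hd, Nat.cast_ofNat]

/-- **`h(ℚ(√24653)) = 4`** (`24653 = 89·277`, `D_29^+`): four cycles of reduced ideals, of lengths `9, 5, 5, 1`, through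
`(59+√D)/134`, `(97+√D)/74`, `(97+√D)/206` and the principal `(157+√D)/2`. [cite: JacobsonWilliams2008, §5.3 Thm. 5.18] -/
theorem classNumber_eq_four_of_discr_eq_24653 (h2 : finrank ℚ K = 2) (hd : NumberField.discr K = 24653) :
    NumberField.classNumber K = 4 :=
  classNumber_eq_length_of_certs h2 (D := 24653) (s := 157) (n := 9) (n' := 9)
    (R := [⟨59, 134⟩, ⟨97, 74⟩, ⟨97, 206⟩, ⟨157, 2⟩]) (by exact_mod_cast hd) (by decide +kernel) (by decide +kernel)

/-- `d_K = 24653`: `h_K · R_K = 4 log ((157 + √24653)/2)` (`= 20.22514…`). [cite: JacobsonWilliams2008, §5.3 (5.33)–(5.34)] -/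
theorem classNumber_mul_regulator_of_discr_eq_24653 (h2 : finrank ℚ K = 2) (hd : NumberField.discr K = 24653) :
    (NumberField.classNumber K : ℝ) * Units.regulator K = 4 * Real.log ((157 + 1 * Real.sqrt 24653) / 2) := by
  rw [classNumber_eq_four_of_discr_eq_24653 h2 hd, regulator_of_discr_eq_24653 h2 hd, Nat.cast_ofNat]

/- Regression (an `example`, the statement being the tree's `classNumber_eq_four_of_discr_eq_1365`, proved there by
Minkowski's bound and relations): `h(ℚ(√1365)) = 4` by cycles — four cycles `4, 6, 2, 2` through `(13+√D)/26`,
`(15+√D)/30`, `(35+√D)/2`, `(35+√D)/10`. -/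
example (h2 : finrank ℚ K = 2) (hd : NumberField.discr K = 1365) : NumberField.classNumber K = 4 :=
  classNumber_eq_length_of_certs h2 (D := 1365) (s := 36) (n := 6) (n' := 6)
    (R := [⟨13, 26⟩, ⟨15, 30⟩, ⟨35, 2⟩, ⟨35, 10⟩]) (by exact_mod_cast hd) (by decide +kernel) (by decide +kernel)

/- Regression (an `example`, the statement being the tree's `classNumber_eq_one_of_discr_eq_225077`, proved there by
inert primes and norm witnesses): `h(ℚ(√225077)) = 1` by cycles — ONE cycle, of length `53`, through `(89+√D)/466`. -/
example (h2 : finrank ℚ K = 2) (hd : NumberField.discr K = 225077) : NumberField.classNumber K = 1 :=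
  classNumber_eq_length_of_certs h2 (D := 225077) (s := 474) (n := 53) (n' := 53)
    (R := [⟨89, 466⟩]) (by exact_mod_cast hd) (by decide +kernel) (by decide +kernel)

end Count

end Quadratic

end Literature.NumberTheory.QuadraticFields

end
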